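import Literature.Analysis.FluidPDE.PassiveVectorGalerkinIdentity
import Literature.Analysis.FunctionSpaces.TorusSpaceTime
import Literature.Analysis.FunctionSpaces.TorusCalculusProofs
import HarnessLib

/-!
# The energy form of the (damped) passive-vector operator on space–time test fields

Analysis/FluidPDE proof-support file (everything proved; no definitions). Slice-integrated energy
identities for smooth space–time test fields `ψ` on `T^d × [0,T)` (`Torus.IsSpaceTimeTest T ψ`) and a
carrier `b` that is weakly divergence free for a.e. `t` — the COERCIVITY computation behind J.-L. Lions'
existence theorem for linear parabolic problems (Lions–Magenes 1972, Chap. 3, Thm. 1.1 and §4.3–4.4;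
Temam 1984, Ch. III §1, (1.30)–(1.33)), here for the passive solenoidal vector / linearised transport
operator `∂ₜψ + (b·∇)ψ + νΔψ` of `Torus.IsWeakPassiveVectorOn` (Yoshida–Kaneda 2000, (4)–(5)):

* `∫_{(0,T)} ∫ ⟪ψ, ∂ₜψ⟫ = -½ ∫ ‖ψ(0)‖²` (`setIntegral_integral_inner_timeDeriv_self`; FTC in time,
  `ψ(T) = 0`);
* `∫ ⟪ψ(t), (b(t)·∇)ψ(t)⟫ = 0` for a.e. `t` (weak incompressibility, the tree's
  `integral_inner_self_convect_eq_zero_of_isWeaklyDivFree`), hence its time integral vanishes;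
* `∫ ⟪ψ(t), Δψ(t)⟫ = -‖∇ψ(t)‖₂² ≤ 0`, hence `∫_{(0,T)} ∫⟪ψ, Δψ⟫ ≤ 0`;
* **coercivity of the damped form** (`setIntegral_passiveForm_ge`): for `ν ≥ 0`,
  `-∫_{(0,T)} ∫ ⟪ψ, ∂ₜψ - ψ + (b·∇)ψ + νΔψ⟫ ≥ ∫_{(0,T)}∫‖ψ‖² + ½∫‖ψ(0)‖²`
  — the damping `-ψ` is the substitution `v = e^{-t} w` which makes Lions' size function
  `q(ψ)² = ‖ψ‖²_{L²} + ½‖ψ(0)‖²` work without Poincaré / mean-zero hypotheses.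

Consumer: existence of A0 weak solutions (stub `stub_existence` of support item `CascadeBookkeeping`,
route `SolenoidalFractalHomogenisation`, cell `ad-ideate`) via `OperatorTheory.LionsProjection`.

## Mathlib / tree search

Tree: `TorusSpaceTime` (`IsSmoothSpaceTimeOn.inner/.timeDerivWithin_inner/.hasDerivWithinAt_integral`),
`TorusCalculusProofs` (`integral_inner_laplacian_eq_neg_holds`), `NSUniqueness2DProofs`
(`integral_inner_self_convect_eq_zero_of_isWeaklyDivFree`), `PassiveVectorGalerkinIdentity`
(`integrable_inner_convect_of_integrable_smul`), `TorusWeakFormBookkeeping` (`IsSpaceTimeTest.exists_bound*`).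
Mathlib: `intervalIntegral.integral_eq_sub_of_hasDerivAt`.

## References

* J.-L. Lions, E. Magenes, *Non-homogeneous boundary value problems and applications* I (1972), Chap. 3,
  Thm. 1.1, §4. [`LionsMagenes1972`]
* R. Temam, *Navier–Stokes Equations*, 3rd ed. (1984), Ch. III §1.1, (1.30)–(1.33). [`Temam1984`]
* K. Yoshida, Y. Kaneda, Phys. Rev. E 63 (2000) 016308, §II eq. (4)–(5). [`YoshidaKaneda2000`]
-/

noncomputable section

open MeasureTheory Set Filter Function TopologicalSpace
open scoped ENNReal NNReal InnerProductSpace Topology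

namespace Literature.Analysis.FluidPDE

namespace Torus

variable {d : Type*} [Fintype d] [DecidableEq d]

/-! ## The time-derivative term -/

omit [DecidableEq d] in
/-- **`∫_{(0,T)} ∫ ⟪ψ, ∂ₜψ⟫ = -½ ∫ ‖ψ(0)‖²`** for a space–time test field on `[0,T)`, `T > 0`
(`t ↦ ∫‖ψ(t)‖²` is `C¹` with derivative `2∫⟪ψ,∂ₜψ⟫` and vanishes at `t = T`; Temam 1984, Ch. III
(1.31)). [cite: Temam1984, Ch. III §1.1 (1.31)] -/
theorem setIntegral_integral_inner_timeDeriv_self {T : ℝ} {ψ : ℝ → UnitAddTorus d → EuclideanSpace ℝ d}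
    (hψ : FunctionSpaces.Torus.IsSpaceTimeTest T ψ) (hT : 0 < T) :
    ∫ t in Ioo 0 T, ∫ x, ⟪ψ t x, FunctionSpaces.Torus.timeDeriv ψ t x⟫_ℝ = -(1 / 2) * ∫ x, ‖ψ 0 x‖ ^ 2 := by
  obtain ⟨hs, T', hT'T, hT'⟩ := id hψ
  have hψu : FunctionSpaces.Torus.IsSmoothSpaceTimeOn univ ψ := hψ.isSmoothSpaceTimeOn univ
  have hθ : FunctionSpaces.Torus.IsSmoothSpaceTimeOn univ (fun t y => ⟪ψ t y, ψ t y⟫_ℝ) := hψu.inner hψu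
  -- the time derivative of `⟪ψ, ψ⟫`
  have hθ' : ∀ t y, FunctionSpaces.Torus.timeDerivWithin univ (fun t y => ⟪ψ t y, ψ t y⟫_ℝ) t y =
      2 * ⟪ψ t y, FunctionSpaces.Torus.timeDeriv ψ t y⟫_ℝ := by
    intro t y
    rw [hψu.timeDerivWithin_inner hψu uniqueDiffOn_univ (mem_univ t),
      FunctionSpaces.Torus.timeDerivWithin_eq_timeDeriv_of_contDiff hs uniqueDiffOn_univ (mem_univ t),
      real_inner_comm (FunctionSpaces.Torus.timeDeriv ψ t y)]
    ring
  have hderiv : ∀ t, HasDerivAt (fun s => ∫ y, ⟪ψ s y, ψ s y⟫_ℝ)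
      (2 * ∫ y, ⟪ψ t y, FunctionSpaces.Torus.timeDeriv ψ t y⟫_ℝ) t := by
    intro t
    have h := (hθ.hasDerivWithinAt_integral convex_univ (mem_univ t)).hasDerivAt univ_mem
    have e : ∫ y, FunctionSpaces.Torus.timeDerivWithin univ (fun t y => ⟪ψ t y, ψ t y⟫_ℝ) t y =
        2 * ∫ y, ⟪ψ t y, FunctionSpaces.Torus.timeDeriv ψ t y⟫_ℝ := by
      rw [← integral_const_mul]
      exact integral_congr_ae (ae_of_all _ fun y => hθ' t y)
    rwa [e] at h
  have hcont : Continuous fun t => 2 * ∫ y, ⟪ψ t y, FunctionSpaces.Torus.timeDeriv ψ t y⟫_ℝ := by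
    have hc : Continuous fun t => ∫ y, ⟪ψ t y, FunctionSpaces.Torus.timeDeriv ψ t y⟫_ℝ := by
      have h := (hψu.inner (hψ.timeDeriv.isSmoothSpaceTimeOn univ)).continuousOn_integral convex_univ
      exact continuousOn_univ.1 h
    exact continuous_const.mul hc
  have hFTC := intervalIntegral.integral_eq_sub_of_hasDerivAt (a := 0) (b := T) (fun t _ => hderiv t)
    (hcont.intervalIntegrable _ _)
  rw [intervalIntegral.integral_of_le hT.le, integral_Ioc_eq_integral_Ioo] at hFTC
  have hTzero : ∫ y, ⟪ψ T y, ψ T y⟫_ℝ = 0 := by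
    rw [hT' T hT'T.le]
    simp
  have h2 : ∫ t in Ioo 0 T, 2 * ∫ y, ⟪ψ t y, FunctionSpaces.Torus.timeDeriv ψ t y⟫_ℝ =
      2 * ∫ t in Ioo 0 T, ∫ y, ⟪ψ t y, FunctionSpaces.Torus.timeDeriv ψ t y⟫_ℝ := integral_const_mul _ _
  rw [h2, hTzero, zero_sub] at hFTC
  have e0 : ∫ y, ⟪ψ 0 y, ψ 0 y⟫_ℝ = ∫ y, ‖ψ 0 y‖ ^ 2 :=
    integral_congr_ae (ae_of_all _ fun y => real_inner_self_eq_norm_sq _)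
  rw [e0] at hFTC
  linarith

/-! ## The transport term -/

omit [DecidableEq d] in
/-- **The transport term vanishes slice-wise**: if `b(t)` is weakly divergence free for a.e.
`t ∈ (0,T)`, then `∫⟪ψ(t), (b(t)·∇)ψ(t)⟫ = 0` for a.e. `t` (test weak incompressibility with
`½‖ψ(t)‖²`; Temam 1984, Ch. III Lemma 1.3, `b(u,v,v) = 0`). [cite: Temam1984, Ch. III §1 Lemma 1.3] -/
theorem ae_integral_inner_convect_self_eq_zero {T : ℝ} {b ψ : ℝ → UnitAddTorus d → EuclideanSpace ℝ d}
    (hψ : FunctionSpaces.Torus.IsSpaceTimeTest T ψ)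
    (hb : ∀ᵐ t ∂(volume.restrict (Ioo 0 T)), FunctionSpaces.Torus.IsWeaklyDivFree (b t)) :
    ∀ᵐ t ∂(volume.restrict (Ioo 0 T)), ∫ x, ⟪ψ t x, FunctionSpaces.Torus.convect (b t) (ψ t) x⟫_ℝ = 0 := by
  filter_upwards [hb] with t ht
  exact integral_inner_self_convect_eq_zero_of_isWeaklyDivFree ht (hψ.isSmooth_slice t)

omit [DecidableEq d] in
/-- Hence the space–time transport term vanishes: `∫_{(0,T)} ∫⟪ψ, (b·∇)ψ⟫ = 0`.
[cite: Temam1984, Ch. III §1 Lemma 1.3] -/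
theorem setIntegral_integral_inner_convect_self_eq_zero {T : ℝ} {b ψ : ℝ → UnitAddTorus d → EuclideanSpace ℝ d}
    (hψ : FunctionSpaces.Torus.IsSpaceTimeTest T ψ)
    (hb : ∀ᵐ t ∂(volume.restrict (Ioo 0 T)), FunctionSpaces.Torus.IsWeaklyDivFree (b t)) :
    ∫ t in Ioo 0 T, ∫ x, ⟪ψ t x, FunctionSpaces.Torus.convect (b t) (ψ t) x⟫_ℝ = 0 := by
  rw [integral_congr_ae (ae_integral_inner_convect_self_eq_zero hψ hb)]
  simp

/-! ## The viscous term -/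

/-- **The viscous term is dissipative slice-wise**: `∫⟪ψ(t), Δψ(t)⟫ = -‖∇ψ(t)‖₂² ≤ 0`
(Green's identity on `T^d`, `integral_inner_laplacian_eq_neg_holds`). [cite: Temam1984, Ch. III §1.1 (1.30)] -/
theorem integral_inner_self_laplacian_eq_neg_gradNormSq {ψ : UnitAddTorus d → EuclideanSpace ℝ d}
    (hψ : FunctionSpaces.Torus.IsSmooth ψ) :
    ∫ x, ⟪ψ x, FunctionSpaces.Torus.laplacian ψ x⟫_ℝ = -FunctionSpaces.Torus.gradNormSq ψ := by
  rw [FunctionSpaces.Torus.integral_inner_laplacian_eq_neg_holds hψ, FunctionSpaces.Torus.gradNormSq,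
    integral_finsetSum _ fun i _ => ((hψ.partialDeriv i).norm_sq).integrable]

/-- `∫_{(0,T)} ∫⟪ψ, Δψ⟫ ≤ 0` for a space–time test field. [cite: Temam1984, Ch. III §1.1 (1.30)] -/
theorem setIntegral_integral_inner_laplacian_self_nonpos {T : ℝ} {ψ : ℝ → UnitAddTorus d → EuclideanSpace ℝ d}
    (hψ : FunctionSpaces.Torus.IsSpaceTimeTest T ψ) :
    ∫ t in Ioo 0 T, ∫ x, ⟪ψ t x, FunctionSpaces.Torus.laplacian (ψ t) x⟫_ℝ ≤ 0 := by
  refine setIntegral_nonpos measurableSet_Ioo fun t _ => ?_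
  rw [integral_inner_self_laplacian_eq_neg_gradNormSq (hψ.isSmooth_slice t), neg_nonpos]
  exact FunctionSpaces.Torus.gradNormSq_nonneg _

/-! ## Integrability of the slice pairings in time -/

omit [DecidableEq d] in
/-- `t ↦ ∫⟪ψ(t), Φ(t)⟫` is integrable on `(0,T)` for a test field `ψ` and a jointly continuous `Φ`
(both bounded on `[0,T] × T^d`). [cite: Temam1984, Ch. III §1.1] -/
theorem integrableOn_integral_inner_of_continuous {T : ℝ} {ψ Φ : ℝ → UnitAddTorus d → EuclideanSpace ℝ d}
    (hψ : FunctionSpaces.Torus.IsSpaceTimeTest T ψ) (hΦ : Continuous (uncurry Φ)) :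
    IntegrableOn (fun t => ∫ x, ⟪ψ t x, Φ t x⟫_ℝ) (Ioo 0 T) := by
  obtain ⟨C₁, hC₁⟩ := hψ.exists_bound (isCompact_Icc (a := (0:ℝ)) (b := T))
  obtain ⟨C₂, hC₂⟩ := exists_bound_of_continuous_uncurry hΦ 0 T
  have hm : AEStronglyMeasurable (fun t => ∫ x, ⟪ψ t x, Φ t x⟫_ℝ) (volume.restrict (Ioo 0 T)) := by
    have hc : Continuous (uncurry fun t x => ⟪ψ t x, Φ t x⟫_ℝ) := hψ.continuous_uncurry.inner hΦ
    exact (hc.aestronglyMeasurable (μ := ((volume : Measure ℝ).restrict (Ioo 0 T)).prod volume)).integral_prod_right'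
  refine IntegrableOn.of_bound measure_Ioo_lt_top hm (C₁ * C₂) ?_
  filter_upwards [ae_restrict_mem measurableSet_Ioo] with t ht
  rw [Real.norm_eq_abs]
  calc |∫ x, ⟪ψ t x, Φ t x⟫_ℝ| ≤ ∫ x, |⟪ψ t x, Φ t x⟫_ℝ| := abs_integral_le_integral_abs
    _ ≤ ∫ _x, C₁ * C₂ := by
        refine integral_mono_of_nonneg (ae_of_all _ fun x => abs_nonneg _) (integrable_const _)
          (ae_of_all _ fun x => ?_)
        calc |⟪ψ t x, Φ t x⟫_ℝ| ≤ ‖ψ t x‖ * ‖Φ t x‖ := abs_real_inner_le_norm _ _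
          _ ≤ C₁ * C₂ := mul_le_mul (hC₁ t (Ioo_subset_Icc_self ht) x) (hC₂ t (Ioo_subset_Icc_self ht) x)
              (norm_nonneg _) ((norm_nonneg _).trans (hC₁ t (Ioo_subset_Icc_self ht) x))
    _ = C₁ * C₂ := by simp

omit [DecidableEq d] in
/-- Points of `(0,T) × T^d` have their time coordinate in `(0,T)`, a.e. [folklore] -/
private theorem ae_fst_mem_Ioo_prod (T : ℝ) :
    ∀ᵐ p : ℝ × UnitAddTorus d ∂(((volume : Measure ℝ).restrict (Ioo 0 T)).prod volume), p.1 ∈ Ioo 0 T :=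
  (Measure.quasiMeasurePreserving_fst (μ := (volume : Measure ℝ).restrict (Ioo 0 T))
    (ν := (volume : Measure (UnitAddTorus d)))).ae (ae_restrict_mem measurableSet_Ioo)

/-- The space–time transport pairing `⟪ψ, (b·∇)ψ⟫` of a test field is integrable on `(0,T) × T^d` when
`‖b‖ ≤ M` a.e. there (jointly measurable `b`). [cite: Temam1984, Ch. III §1 Lemma 1.3] -/
theorem integrable_inner_convect_self_prod {T : ℝ} {b ψ : ℝ → UnitAddTorus d → EuclideanSpace ℝ d}
    (hψ : FunctionSpaces.Torus.IsSpaceTimeTest T ψ)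
    (hbm : AEStronglyMeasurable (uncurry b) (((volume : Measure ℝ).restrict (Ioo 0 T)).prod volume)) {M : ℝ}
    (hbM : ∀ᵐ p ∂(((volume : Measure ℝ).restrict (Ioo 0 T)).prod (volume : Measure (UnitAddTorus d))),
      ‖uncurry b p‖ ≤ M) :
    Integrable (fun p : ℝ × UnitAddTorus d => ⟪ψ p.1 p.2, FunctionSpaces.Torus.convect (b p.1) (ψ p.1) p.2⟫_ℝ)
      (((volume : Measure ℝ).restrict (Ioo 0 T)).prod volume) := by
  obtain ⟨C₁, hC₁⟩ := hψ.exists_bound (isCompact_Icc (a := (0:ℝ)) (b := T))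
  obtain ⟨C₂, -, hC₂⟩ := hψ.exists_bound_sum_partialDeriv (isCompact_Icc (a := (0:ℝ)) (b := T))
  have hψ1 : ∀ t, FunctionSpaces.Torus.IsContDiff 1 (ψ t) := fun t => (hψ.isSmooth_slice t).isContDiff (by simp)
  have hm : AEStronglyMeasurable
      (fun p : ℝ × UnitAddTorus d => ⟪ψ p.1 p.2, FunctionSpaces.Torus.convect (b p.1) (ψ p.1) p.2⟫_ℝ)
      (((volume : Measure ℝ).restrict (Ioo 0 T)).prod volume) := by
    have e : (fun p : ℝ × UnitAddTorus d => ⟪ψ p.1 p.2, FunctionSpaces.Torus.convect (b p.1) (ψ p.1) p.2⟫_ℝ) =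
        fun p => ∑ j, b p.1 p.2 j * ⟪ψ p.1 p.2, FunctionSpaces.Torus.partialDeriv j (ψ p.1) p.2⟫_ℝ := by
      funext p
      exact IsWeakPassiveVectorOn.inner_convect_eq_sum' (hψ1 p.1) _ _ _
    rw [e]
    refine Finset.aestronglyMeasurable_fun_sum _ fun j _ => ?_
    exact ((EuclideanSpace.proj j).continuous.comp_aestronglyMeasurable hbm).mul
      ((hψ.continuous_uncurry.inner (hψ.continuous_uncurry_lineDeriv (EuclideanSpace.single j 1))).aestronglyMeasurable)
  refine Integrable.of_bound hm (C₁ * (M * C₂)) ?_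
  filter_upwards [hbM, ae_fst_mem_Ioo_prod (d := d) T] with p hp hpI
  have ht : p.1 ∈ Icc 0 T := Ioo_subset_Icc_self hpI
  rw [Real.norm_eq_abs]
  calc |⟪ψ p.1 p.2, FunctionSpaces.Torus.convect (b p.1) (ψ p.1) p.2⟫_ℝ|
      ≤ ‖ψ p.1 p.2‖ * ‖FunctionSpaces.Torus.convect (b p.1) (ψ p.1) p.2‖ := abs_real_inner_le_norm _ _
    _ ≤ ‖ψ p.1 p.2‖ * (‖b p.1 p.2‖ * ∑ j, ‖FunctionSpaces.Torus.partialDeriv j (ψ p.1) p.2‖) :=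
        mul_le_mul_of_nonneg_left (FunctionSpaces.Torus.norm_convect_le _ (hψ1 p.1) p.2) (norm_nonneg _)
    _ ≤ C₁ * (M * C₂) := by
        refine mul_le_mul (hC₁ p.1 ht p.2) (mul_le_mul hp (hC₂ p.1 ht p.2)
          (Finset.sum_nonneg fun j _ => norm_nonneg _) ((norm_nonneg _).trans hp)) (by positivity)
          ((norm_nonneg _).trans (hC₁ p.1 ht p.2))

/-! ## Coercivity of the damped form -/

/-- **Coercivity of the damped passive-vector form on test fields** (Lions–Magenes 1972, Chap. 3,
(4.19)–(4.21); Temam 1984, Ch. III (1.30)–(1.33)): for `T > 0`, `ν ≥ 0`, a carrier `b` bounded a.e. on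
`(0,T) × T^d` and weakly divergence free for a.e. `t`, and a space–time test field `ψ` on `[0,T)`,
`∫_{(0,T)}∫‖ψ‖² + ½∫‖ψ(0)‖² ≤ -∫_{(0,T)} ∫ ⟪ψ, ∂ₜψ - ψ + (b·∇)ψ + νΔψ⟫`.
[cite: LionsMagenes1972, Chap. 3 Thm. 1.1 and §4.3] -/
theorem setIntegral_passiveForm_ge {T ν : ℝ} (hT : 0 < T) (hν : 0 ≤ ν)
    {b ψ : ℝ → UnitAddTorus d → EuclideanSpace ℝ d} (hψ : FunctionSpaces.Torus.IsSpaceTimeTest T ψ)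
    (hbdiv : ∀ᵐ t ∂(volume.restrict (Ioo 0 T)), FunctionSpaces.Torus.IsWeaklyDivFree (b t))
    (hbm : AEStronglyMeasurable (uncurry b) (((volume : Measure ℝ).restrict (Ioo 0 T)).prod volume)) {M : ℝ}
    (hbM : ∀ᵐ p ∂(((volume : Measure ℝ).restrict (Ioo 0 T)).prod (volume : Measure (UnitAddTorus d))),
      ‖uncurry b p‖ ≤ M) :
    (∫ t in Ioo 0 T, ∫ x, ‖ψ t x‖ ^ 2) + (1 / 2) * ∫ x, ‖ψ 0 x‖ ^ 2 ≤
      -(∫ t in Ioo 0 T, ∫ x, ⟪ψ t x, FunctionSpaces.Torus.timeDeriv ψ t x - ψ t x +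
          FunctionSpaces.Torus.convect (b t) (ψ t) x + ν • FunctionSpaces.Torus.laplacian (ψ t) x⟫_ℝ) := by
  -- slice integrability
  have hcψ : Continuous (uncurry ψ) := hψ.continuous_uncurry
  have iA : ∀ t, Integrable (fun x => ⟪ψ t x, FunctionSpaces.Torus.timeDeriv ψ t x⟫_ℝ) volume := fun t =>
    ((hψ.isSmooth_slice t).continuous.inner (hψ.timeDeriv.isSmooth_slice t).continuous).integrable_of_hasCompactSupport
      (HasCompactSupport.of_compactSpace _)
  have iS : ∀ t, Integrable (fun x => ⟪ψ t x, ψ t x⟫_ℝ) volume := fun t =>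
    ((hψ.isSmooth_slice t).continuous.inner (hψ.isSmooth_slice t).continuous).integrable_of_hasCompactSupport
      (HasCompactSupport.of_compactSpace _)
  have iL : ∀ t, Integrable (fun x => ⟪ψ t x, FunctionSpaces.Torus.laplacian (ψ t) x⟫_ℝ) volume := fun t =>
    ((hψ.isSmooth_slice t).continuous.inner (hψ.isSmooth_slice t).laplacian.continuous).integrable_of_hasCompactSupport
      (HasCompactSupport.of_compactSpace _)
  have hprod := integrable_inner_convect_self_prod hψ hbm hbM
  have iC : ∀ᵐ t ∂(volume.restrict (Ioo 0 T)),
      Integrable (fun x => ⟪ψ t x, FunctionSpaces.Torus.convect (b t) (ψ t) x⟫_ℝ) volume := hprod.prod_right_ae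
  -- the slice identity
  have hslice : ∀ᵐ t ∂(volume.restrict (Ioo 0 T)),
      ∫ x, ⟪ψ t x, FunctionSpaces.Torus.timeDeriv ψ t x - ψ t x +
          FunctionSpaces.Torus.convect (b t) (ψ t) x + ν • FunctionSpaces.Torus.laplacian (ψ t) x⟫_ℝ =
        (∫ x, ⟪ψ t x, FunctionSpaces.Torus.timeDeriv ψ t x⟫_ℝ) - (∫ x, ‖ψ t x‖ ^ 2) +
          (∫ x, ⟪ψ t x, FunctionSpaces.Torus.convect (b t) (ψ t) x⟫_ℝ) +
            ν * ∫ x, ⟪ψ t x, FunctionSpaces.Torus.laplacian (ψ t) x⟫_ℝ := by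
    filter_upwards [iC] with t ht
    have e : (fun x => ⟪ψ t x, FunctionSpaces.Torus.timeDeriv ψ t x - ψ t x +
        FunctionSpaces.Torus.convect (b t) (ψ t) x + ν • FunctionSpaces.Torus.laplacian (ψ t) x⟫_ℝ) =
        fun x => ⟪ψ t x, FunctionSpaces.Torus.timeDeriv ψ t x⟫_ℝ - ⟪ψ t x, ψ t x⟫_ℝ +
          ⟪ψ t x, FunctionSpaces.Torus.convect (b t) (ψ t) x⟫_ℝ + ν * ⟪ψ t x, FunctionSpaces.Torus.laplacian (ψ t) x⟫_ℝ := by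
      funext x
      rw [inner_add_right, inner_add_right, inner_sub_right, real_inner_smul_right]
    have h12 : Integrable (fun x => ⟪ψ t x, FunctionSpaces.Torus.timeDeriv ψ t x⟫_ℝ - ⟪ψ t x, ψ t x⟫_ℝ) volume :=
      (iA t).sub (iS t)
    have h123 : Integrable (fun x => ⟪ψ t x, FunctionSpaces.Torus.timeDeriv ψ t x⟫_ℝ - ⟪ψ t x, ψ t x⟫_ℝ +
        ⟪ψ t x, FunctionSpaces.Torus.convect (b t) (ψ t) x⟫_ℝ) volume := h12.add ht
    have h4 : Integrable (fun x => ν * ⟪ψ t x, FunctionSpaces.Torus.laplacian (ψ t) x⟫_ℝ) volume := (iL t).const_mul ν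
    rw [e, integral_add h123 h4, integral_add h12 ht, integral_sub (iA t) (iS t), integral_const_mul,
      integral_congr_ae (ae_of_all _ fun x => real_inner_self_eq_norm_sq (ψ t x))]
  -- time integrability of the four slice terms
  have IA : IntegrableOn (fun t => ∫ x, ⟪ψ t x, FunctionSpaces.Torus.timeDeriv ψ t x⟫_ℝ) (Ioo 0 T) :=
    integrableOn_integral_inner_of_continuous hψ hψ.timeDeriv.continuous_uncurry
  have IS : IntegrableOn (fun t => ∫ x, ‖ψ t x‖ ^ 2) (Ioo 0 T) := by
    refine (integrableOn_integral_inner_of_continuous hψ hcψ).congr (ae_of_all _ fun t => ?_)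
    exact integral_congr_ae (ae_of_all _ fun x => real_inner_self_eq_norm_sq (ψ t x))
  have IC : IntegrableOn (fun t => ∫ x, ⟪ψ t x, FunctionSpaces.Torus.convect (b t) (ψ t) x⟫_ℝ) (Ioo 0 T) :=
    hprod.integral_prod_left
  have IL : IntegrableOn (fun t => ∫ x, ⟪ψ t x, FunctionSpaces.Torus.laplacian (ψ t) x⟫_ℝ) (Ioo 0 T) :=
    integrableOn_integral_inner_of_continuous hψ hψ.continuous_uncurry_laplacian
  -- assemble
  have H12 : IntegrableOn (fun t => (∫ x, ⟪ψ t x, FunctionSpaces.Torus.timeDeriv ψ t x⟫_ℝ) - ∫ x, ‖ψ t x‖ ^ 2) (Ioo 0 T) :=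
    IA.sub IS
  have H123 : IntegrableOn (fun t => (∫ x, ⟪ψ t x, FunctionSpaces.Torus.timeDeriv ψ t x⟫_ℝ) - (∫ x, ‖ψ t x‖ ^ 2) +
      ∫ x, ⟪ψ t x, FunctionSpaces.Torus.convect (b t) (ψ t) x⟫_ℝ) (Ioo 0 T) := H12.add IC
  have H4 : IntegrableOn (fun t => ν * ∫ x, ⟪ψ t x, FunctionSpaces.Torus.laplacian (ψ t) x⟫_ℝ) (Ioo 0 T) := IL.const_mul ν
  rw [integral_congr_ae hslice, integral_add H123 H4, integral_add H12 IC, integral_sub IA IS, integral_const_mul,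
    setIntegral_integral_inner_timeDeriv_self hψ hT, setIntegral_integral_inner_convect_self_eq_zero hψ hbdiv]
  have hL0 := setIntegral_integral_inner_laplacian_self_nonpos hψ
  have hL : ν * (∫ t in Ioo 0 T, ∫ x, ⟪ψ t x, FunctionSpaces.Torus.laplacian (ψ t) x⟫_ℝ) ≤ 0 := by nlinarith
  linarith
end Torus

end Literature.Analysis.FluidPDE

end
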